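import Literature.NumberTheory.ModularForms.MinkowskiReductionRegionQ
import HarnessLib

/-!
# Klingen §2, remark after Definition 2: the regions `Q_n(t)` are open in `P_n`

H. Klingen, *Introductory Lectures on Siegel Modular Forms* (Cambridge Studies in Advanced Mathematics
20, CUP 1990), §2 "Minkowski's reduction theory", the remark after Definition 2 (p. 22): "These are
open subsets of `P_n` which exhaust `P_n` for `t` tending to infinity". The exhaustion is
`exists_subset_regionQ_of_isCompact` in `MinkowskiReductionRegionQ`; this file adds the openness.
Row g11-#10 (rider) of the `lit-hodgefound` lane (prover p25).

## Lean rendering (namespace `Literature.NumberTheory.ModularForms.MinkowskiReduction`)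

`P_n = {y | y.PosDef}` is not open in the space `M_n(ℝ)` of all real matrices (it lies in the closed
subspace of symmetric ones), so "open in `P_n`" is rendered as: `Q_n(t) = P_n ∩ U` for a set `U` open in
`M_n(ℝ)` — **`exists_isOpen_regionQ_eq`** (conditions (i)–(iii) of Definition 2 are finitely many strict
inequalities between continuous functions of `y`).
-/

noncomputable section

open Matrix Finset

namespace Literature.NumberTheory.ModularForms

namespace MinkowskiReduction

variable {n : ℕ}

/-- **"These are open subsets of `P_n`"**: `Q_n(t) = P_n ∩ U` with `U` open in the space of all real
`n × n` matrices (conditions (i)–(iii) are finitely many strict inequalities between continuous functions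
of `y`). [cite: Klingen1990, §2 remark after Def 2 (p. 22)] -/
theorem exists_isOpen_regionQ_eq (c₁ t : ℝ) :
    ∃ U : Set (Matrix (Fin n) (Fin n) ℝ), IsOpen U ∧ regionQ n c₁ t = {y | y.PosDef} ∩ U := by
  have hent : ∀ i j : Fin n, Continuous fun y : Matrix (Fin n) (Fin n) ℝ => y i j := fun i j =>
    (continuous_apply j).comp (continuous_apply i)
  refine ⟨{y | ∀ i j : Fin n, (j : ℕ) = i + 1 → y i i < t * y j j} ∩
    ({y | ∀ i j : Fin n, i < j → 2 * |y i j| < t * y i i} ∩ {y | ∏ i, y i i < c₁ * t * y.det}), ?_, ?_⟩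
  · refine IsOpen.inter ?_ (IsOpen.inter ?_ ?_)
    · rw [Set.setOf_forall]
      refine isOpen_iInter_of_finite fun i => ?_
      rw [Set.setOf_forall]
      refine isOpen_iInter_of_finite fun j => ?_
      by_cases h : (j : ℕ) = i + 1
      · simp only [h, forall_true_left]
        exact isOpen_lt (hent i i) ((hent j j).const_smul t)
      · simp only [h, IsEmpty.forall_iff, Set.setOf_true]
        exact isOpen_univ
    · rw [Set.setOf_forall]
      refine isOpen_iInter_of_finite fun i => ?_
      rw [Set.setOf_forall]
      refine isOpen_iInter_of_finite fun j => ?_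
      by_cases h : i < j
      · simp only [h, forall_true_left]
        exact isOpen_lt ((hent i j).abs.const_smul (2 : ℝ)) ((hent i i).const_smul t)
      · simp only [h, IsEmpty.forall_iff, Set.setOf_true]
        exact isOpen_univ
    · exact isOpen_lt (continuous_finsetProd _ fun i _ => hent i i)
        ((continuous_id.matrix_det).const_smul (c₁ * t))
  · ext y
    simp only [regionQ, Set.mem_setOf_eq, Set.mem_inter_iff]

end MinkowskiReduction

end Literature.NumberTheory.ModularForms
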